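import Summits.Ventures.CertifiedManyBodySolver.Downfold.EmeryOrbitalWeightFaceBox
import Summits.Ventures.CertifiedManyBodySolver.Downfold.EmeryVanHoveSubBox
import Summits.Ventures.CertifiedManyBodySolver.Downfold.EmeryVanHoveTableA
import Summits.Ventures.CertifiedManyBodySolver.Downfold.EmeryFermiFacePointsNdNiO2YK26NH109S1
import Summits.Ventures.CertifiedManyBodySolver.Downfold.EmeryFermiFacePointsNdNiO2YK26NH109S2
import Summits.Ventures.CertifiedManyBodySolver.Downfold.EmeryFermiFacePointsNdNiO2YK26NH109S3
import HarnessLib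

/-!
# THE ANTINODAL FERMI-SURFACE Cu-d WEIGHT OVER THE TYPED 3BE BOX `emeryBoxNdNiO2YK26Src (EmeryBoxesKSlicesD)` AT FILLING n_H = 1.09 (ν = 91/200) — the kinematic leg of the UPPER member `U_B∣full(w_antinode)` of the weak
# band-level `U` bracket read over a box (INFL-3to1-B §B.90; kernel `EmeryOrbitalWeightFaceBox`; router/OBJECT-E-BUDGET.tsv §C)

Venture CertifiedManyBodySolver, cell `pub/hubbard-downfold` (stage S1), seat hubbard-downfold-mod-4 (technique B, g38); namespace
`Summit.Ventures.CertifiedManyBodySolver.Downfold.Emery`. Everything PROVED (0 sorry). WHAT THIS IS NOT: a statement about the material — the typed box (NdNiO₂ ((K)+YNiO₂ proxy source box; n_H 1.09))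
is SCREENING-GRADE; `U = 0` one-body kinematics of the σ model; the `U_B` arithmetic that consumes the window is DERIVED context on the MEAN-FIELD annex (R-B17).

For every member θ = (Δ, t_pd, t_pp, t_pp′) ∈ [3.97, 5] × [1.17, 1.37] × [0.56, 0.68] × [0.121, 0.123] eV at filling ν = 91/200, the Cu-d weight of the ANTINODAL Bloch state (the zone-face
point of the member's own Fermi surface — the MOST Cu-like Fermi point, `EmeryOrbitalWeightMonotone`), `dWeightFace θ (fermiEnergyOf θ ν)`, lies in the window below.
DEVICE: `W(θ) = W(Δ/t_pd, 1, t_pp/t_pd, t_pp′/t_pd)` (scaling law); the t_pd range is cut into 3 slabs; on each normalised slab the THREE-COORDINATE CORNER RULE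
`dWeightFace_fermiEnergyOf_mem_Icc_of_mem_box3_num` (levers Δ ↑, t_pp ↓, t_pp′ ↑ at fixed filling; hole-likeness from the slab's `vhBoxCheck` + the Ψ table; the upper
face edge from four corner inequalities; the antinodal charge-transfer regime `4(t_pp + t_pp′) ≤ Δ + ε_F` at two corners) is read on three K = 384 Fermi-energy brackets
(`EmeryFermiFacePointsNdNiO2YK26NH109S<k>`). The slab corners `(Δ₂/a₁, 1, b₁/a₂, c₂/a₁)` are VIRTUAL (not members): the window is a sound ENCLOSURE, a few 10⁻³ wider than the image.

| t_pd slab (eV) | normalised slab Δ/t_pd × t_pp/t_pd × t_pp′/t_pd | q₁ (vhBoxCheck) ≥ table point | E_h | E_R | E_v | regime margins (R1, R2) | **w_face window** |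
|---|---|---|---|---|---|---|---|
| [1.17, 1.24] | [3.202, 4.274] × [0.4516, 0.5812] × [0.09758, 0.1051] | 0.2670 ≥ 1/4 (Ψ ≤ 0.4328) | 0.9563 | 0.9199 | 0.7543 | +1.376, +2.801 | **[0.8172, 0.8768]** |
| [1.24, 1.3] | [3.054, 4.032] × [0.4308, 0.5484] × [0.09308, 0.09919] | 0.2655 ≥ 1/4 (Ψ ≤ 0.4328) | 0.9823 | 0.9482 | 0.7875 | +1.412, +2.700 | **[0.809, 0.8672]** |
| [1.3, 1.37] | [2.898, 3.846] × [0.4088, 0.5231] × [0.08832, 0.09462] | 0.2597 ≥ 1/4 (Ψ ≤ 0.4328) | 1.0133 | 0.9783 | 0.8139 | +1.405, +2.647 | **[0.7992, 0.8593]** |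
| **whole box** | (hull of the slabs) | | | | | | **[0.7992, 0.8768]** |

Sources: three-band model [HybertsenSchluterChristensen1989, Eq. (1)]; face point of the bilinear contour [AndersenEtAl1995, §6]; [folklore] algebra.
-/

noncomputable section

namespace Summit.Ventures.CertifiedManyBodySolver.Downfold.Emery

open Real Set

/-- **Slab 1 (t_pd ∈ [1.17, 1.24] eV) of `emeryBoxNdNiO2YK26Src (EmeryBoxesKSlicesD)`, ν = 91/200: the antinodal Fermi-surface Cu-d weight of every member lies in `[0.8172, 0.8768]`**
(normalised-slab corner rule; brackets `facePt_NdNiO2YK26_nH109_s1_lo_br` / `_R_br` / `_hi_br`). [folklore] -/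
theorem ndNiO2YK26Box_dWeightFace_nH109_s1 {Δ a b c : ℝ} (hΔ : Δ ∈ Icc ((397 : ℝ) / 100) (5 : ℝ)) (ha : a ∈ Icc ((117 : ℝ) / 100) ((31 : ℝ) / 25)) (hb : b ∈ Icc ((14 : ℝ) / 25) ((17 : ℝ) / 25)) (hc : c ∈ Icc ((121 : ℝ) / 1000) ((123 : ℝ) / 1000)) :
    dWeightFace Δ a b c (fermiEnergyOf Δ a b c ((91 : ℝ) / 200)) ∈ Icc ((2043 : ℝ) / 2500) ((548 : ℝ) / 625) := by
  have ha0 : 0 < a := lt_of_lt_of_le (by norm_num) ha.1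
  rw [dWeightFace_fermiEnergyOf_eq_ratios ha0]
  have hΔn : Δ / a ∈ Icc ((397 : ℝ) / 124) ((500 : ℝ) / 117) := by
    constructor
    · rw [le_div_iff₀ ha0]; linarith [hΔ.1, ha.2]
    · rw [div_le_iff₀ ha0]; linarith [hΔ.2, ha.1]
  have hbn : b / a ∈ Icc ((14 : ℝ) / 31) ((68 : ℝ) / 117) := by
    constructor
    · rw [le_div_iff₀ ha0]; linarith [hb.1, ha.2]
    · rw [div_le_iff₀ ha0]; linarith [hb.2, ha.1]
  have hcn : c / a ∈ Icc ((121 : ℝ) / 1240) ((41 : ℝ) / 390) := by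
    constructor
    · rw [le_div_iff₀ ha0]; linarith [hc.1, ha.2]
    · rw [div_le_iff₀ ha0]; linarith [hc.2, ha.1]
  have hVH : ∀ Δ' b' c' : ℝ, Δ' ∈ Icc ((397 : ℝ) / 124) ((500 : ℝ) / 117) → b' ∈ Icc ((14 : ℝ) / 31) ((68 : ℝ) / 117) → c' ∈ Icc ((121 : ℝ) / 1240) ((41 : ℝ) / 390) →
      1 - 2 * ((91 : ℝ) / 200) ≤ xVH Δ' 1 b' c' := by
    intro Δ' b' c' hΔ' hb' hc'
    have h := xVH_window_of_vhBoxCheck (Δ₁ := ((397 : ℚ) / 124)) (Δ₂ := ((500 : ℚ) / 117)) (a₁ := (1 : ℚ)) (a₂ := (1 : ℚ)) (b₁ := ((14 : ℚ) / 31)) (b₂ := ((68 : ℚ) / 117))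
      (c₁ := ((121 : ℚ) / 1240)) (c₂ := ((41 : ℚ) / 390)) (v₁ := ((1473 : ℚ) / 2000)) (v₂ := ((8921 : ℚ) / 10000)) (e := ((887 : ℚ) / 1000)) (E := ((3701 : ℚ) / 5000))
      (q₁ := ((267 : ℚ) / 1000)) (q₂ := ((897 : ℚ) / 2000)) (by decide +kernel)
      (Δ := Δ') (tpd := 1) (tpp := b') (c := c') (by simpa using hΔ') (by simp) (by simpa using hb') (by simpa using hc')
    obtain ⟨-, -, -, -, -, hwin⟩ := h
    push_cast at hwin
    have ht := vhFrac_1_4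
    have hmono := vhFrac_anti (show (1 / 4 : ℝ) ≤ ((267 : ℝ) / 1000) by norm_num)
    have hnu : ((63817 : ℝ) / 147456) ≤ ((91 : ℝ) / 200) := by norm_num
    linarith [hwin.1, ht.2]
  have hEh := (fermiEnergyOf_of_pointBracketCheck facePt_NdNiO2YK26_nH109_s1_lo_br (by norm_num) (by norm_num) (by norm_num) (ν := (91/200 : ℝ))
    (by push_cast; exact ⟨le_rfl, le_rfl⟩)).2
  have hER := (fermiEnergyOf_of_pointBracketCheck facePt_NdNiO2YK26_nH109_s1_R_br (by norm_num) (by norm_num) (by norm_num) (ν := (91/200 : ℝ))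
    (by push_cast; exact ⟨le_rfl, le_rfl⟩)).2
  have hEv := (fermiEnergyOf_of_pointBracketCheck facePt_NdNiO2YK26_nH109_s1_hi_br (by norm_num) (by norm_num) (by norm_num) (ν := (91/200 : ℝ))
    (by push_cast; exact ⟨le_rfl, le_rfl⟩)).2
  push_cast at hEh hER hEv
  exact dWeightFace_fermiEnergyOf_mem_Icc_of_mem_box3_num (Eh := ((9563 : ℝ) / 10000)) (ER := ((9199 : ℝ) / 10000)) (Ev := ((7543 : ℝ) / 10000))
    (by norm_num) one_pos (by norm_num) (by norm_num) hΔn hbn hcn (by norm_num) (by norm_num) hVH hEh.2 (by norm_num)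
    (by norm_num [faceU, fsD, fsN, cA]) (by norm_num [faceU, fsD, fsN, cA]) (by norm_num [faceU, fsD, fsN, cA]) (by norm_num [faceU, fsD, fsN, cA])
    hER.1 (by norm_num) hEv.1 (by norm_num) (by norm_num) (by norm_num [faceG])
    (by norm_num [dWeightFaceCF, faceN, faceR, fsN]) (by norm_num [dWeightFaceCF, faceN, faceR, fsN])

/-- **Slab 2 (t_pd ∈ [1.24, 1.3] eV) of `emeryBoxNdNiO2YK26Src (EmeryBoxesKSlicesD)`, ν = 91/200: the antinodal Fermi-surface Cu-d weight of every member lies in `[0.809, 0.8672]`**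
(normalised-slab corner rule; brackets `facePt_NdNiO2YK26_nH109_s2_lo_br` / `_R_br` / `_hi_br`). [folklore] -/
theorem ndNiO2YK26Box_dWeightFace_nH109_s2 {Δ a b c : ℝ} (hΔ : Δ ∈ Icc ((397 : ℝ) / 100) (5 : ℝ)) (ha : a ∈ Icc ((31 : ℝ) / 25) ((13 : ℝ) / 10)) (hb : b ∈ Icc ((14 : ℝ) / 25) ((17 : ℝ) / 25)) (hc : c ∈ Icc ((121 : ℝ) / 1000) ((123 : ℝ) / 1000)) :
    dWeightFace Δ a b c (fermiEnergyOf Δ a b c ((91 : ℝ) / 200)) ∈ Icc ((809 : ℝ) / 1000) ((542 : ℝ) / 625) := by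
  have ha0 : 0 < a := lt_of_lt_of_le (by norm_num) ha.1
  rw [dWeightFace_fermiEnergyOf_eq_ratios ha0]
  have hΔn : Δ / a ∈ Icc ((397 : ℝ) / 130) ((125 : ℝ) / 31) := by
    constructor
    · rw [le_div_iff₀ ha0]; linarith [hΔ.1, ha.2]
    · rw [div_le_iff₀ ha0]; linarith [hΔ.2, ha.1]
  have hbn : b / a ∈ Icc ((28 : ℝ) / 65) ((17 : ℝ) / 31) := by
    constructor
    · rw [le_div_iff₀ ha0]; linarith [hb.1, ha.2]
    · rw [div_le_iff₀ ha0]; linarith [hb.2, ha.1]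
  have hcn : c / a ∈ Icc ((121 : ℝ) / 1300) ((123 : ℝ) / 1240) := by
    constructor
    · rw [le_div_iff₀ ha0]; linarith [hc.1, ha.2]
    · rw [div_le_iff₀ ha0]; linarith [hc.2, ha.1]
  have hVH : ∀ Δ' b' c' : ℝ, Δ' ∈ Icc ((397 : ℝ) / 130) ((125 : ℝ) / 31) → b' ∈ Icc ((28 : ℝ) / 65) ((17 : ℝ) / 31) → c' ∈ Icc ((121 : ℝ) / 1300) ((123 : ℝ) / 1240) →
      1 - 2 * ((91 : ℝ) / 200) ≤ xVH Δ' 1 b' c' := by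
    intro Δ' b' c' hΔ' hb' hc'
    have h := xVH_window_of_vhBoxCheck (Δ₁ := ((397 : ℚ) / 130)) (Δ₂ := ((125 : ℚ) / 31)) (a₁ := (1 : ℚ)) (a₂ := (1 : ℚ)) (b₁ := ((28 : ℚ) / 65)) (b₂ := ((17 : ℚ) / 31))
      (c₁ := ((121 : ℚ) / 1300)) (c₂ := ((123 : ℚ) / 1240)) (v₁ := ((3847 : ℚ) / 5000)) (v₂ := ((9203 : ℚ) / 10000)) (e := ((229 : ℚ) / 250)) (E := ((7727 : ℚ) / 10000))
      (q₁ := ((531 : ℚ) / 2000)) (q₂ := ((4327 : ℚ) / 10000)) (by decide +kernel)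
      (Δ := Δ') (tpd := 1) (tpp := b') (c := c') (by simpa using hΔ') (by simp) (by simpa using hb') (by simpa using hc')
    obtain ⟨-, -, -, -, -, hwin⟩ := h
    push_cast at hwin
    have ht := vhFrac_1_4
    have hmono := vhFrac_anti (show (1 / 4 : ℝ) ≤ ((531 : ℝ) / 2000) by norm_num)
    have hnu : ((63817 : ℝ) / 147456) ≤ ((91 : ℝ) / 200) := by norm_num
    linarith [hwin.1, ht.2]
  have hEh := (fermiEnergyOf_of_pointBracketCheck facePt_NdNiO2YK26_nH109_s2_lo_br (by norm_num) (by norm_num) (by norm_num) (ν := (91/200 : ℝ))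
    (by push_cast; exact ⟨le_rfl, le_rfl⟩)).2
  have hER := (fermiEnergyOf_of_pointBracketCheck facePt_NdNiO2YK26_nH109_s2_R_br (by norm_num) (by norm_num) (by norm_num) (ν := (91/200 : ℝ))
    (by push_cast; exact ⟨le_rfl, le_rfl⟩)).2
  have hEv := (fermiEnergyOf_of_pointBracketCheck facePt_NdNiO2YK26_nH109_s2_hi_br (by norm_num) (by norm_num) (by norm_num) (ν := (91/200 : ℝ))
    (by push_cast; exact ⟨le_rfl, le_rfl⟩)).2
  push_cast at hEh hER hEv
  exact dWeightFace_fermiEnergyOf_mem_Icc_of_mem_box3_num (Eh := ((9823 : ℝ) / 10000)) (ER := ((4741 : ℝ) / 5000)) (Ev := ((63 : ℝ) / 80))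
    (by norm_num) one_pos (by norm_num) (by norm_num) hΔn hbn hcn (by norm_num) (by norm_num) hVH hEh.2 (by norm_num)
    (by norm_num [faceU, fsD, fsN, cA]) (by norm_num [faceU, fsD, fsN, cA]) (by norm_num [faceU, fsD, fsN, cA]) (by norm_num [faceU, fsD, fsN, cA])
    hER.1 (by norm_num) hEv.1 (by norm_num) (by norm_num) (by norm_num [faceG])
    (by norm_num [dWeightFaceCF, faceN, faceR, fsN]) (by norm_num [dWeightFaceCF, faceN, faceR, fsN])

/-- **Slab 3 (t_pd ∈ [1.3, 1.37] eV) of `emeryBoxNdNiO2YK26Src (EmeryBoxesKSlicesD)`, ν = 91/200: the antinodal Fermi-surface Cu-d weight of every member lies in `[0.7992, 0.8593]`**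
(normalised-slab corner rule; brackets `facePt_NdNiO2YK26_nH109_s3_lo_br` / `_R_br` / `_hi_br`). [folklore] -/
theorem ndNiO2YK26Box_dWeightFace_nH109_s3 {Δ a b c : ℝ} (hΔ : Δ ∈ Icc ((397 : ℝ) / 100) (5 : ℝ)) (ha : a ∈ Icc ((13 : ℝ) / 10) ((137 : ℝ) / 100)) (hb : b ∈ Icc ((14 : ℝ) / 25) ((17 : ℝ) / 25)) (hc : c ∈ Icc ((121 : ℝ) / 1000) ((123 : ℝ) / 1000)) :
    dWeightFace Δ a b c (fermiEnergyOf Δ a b c ((91 : ℝ) / 200)) ∈ Icc ((999 : ℝ) / 1250) ((8593 : ℝ) / 10000) := by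
  have ha0 : 0 < a := lt_of_lt_of_le (by norm_num) ha.1
  rw [dWeightFace_fermiEnergyOf_eq_ratios ha0]
  have hΔn : Δ / a ∈ Icc ((397 : ℝ) / 137) ((50 : ℝ) / 13) := by
    constructor
    · rw [le_div_iff₀ ha0]; linarith [hΔ.1, ha.2]
    · rw [div_le_iff₀ ha0]; linarith [hΔ.2, ha.1]
  have hbn : b / a ∈ Icc ((56 : ℝ) / 137) ((34 : ℝ) / 65) := by
    constructor
    · rw [le_div_iff₀ ha0]; linarith [hb.1, ha.2]
    · rw [div_le_iff₀ ha0]; linarith [hb.2, ha.1]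
  have hcn : c / a ∈ Icc ((121 : ℝ) / 1370) ((123 : ℝ) / 1300) := by
    constructor
    · rw [le_div_iff₀ ha0]; linarith [hc.1, ha.2]
    · rw [div_le_iff₀ ha0]; linarith [hc.2, ha.1]
  have hVH : ∀ Δ' b' c' : ℝ, Δ' ∈ Icc ((397 : ℝ) / 137) ((50 : ℝ) / 13) → b' ∈ Icc ((56 : ℝ) / 137) ((34 : ℝ) / 65) → c' ∈ Icc ((121 : ℝ) / 1370) ((123 : ℝ) / 1300) →
      1 - 2 * ((91 : ℝ) / 200) ≤ xVH Δ' 1 b' c' := by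
    intro Δ' b' c' hΔ' hb' hc'
    have h := xVH_window_of_vhBoxCheck (Δ₁ := ((397 : ℚ) / 137)) (Δ₂ := ((50 : ℚ) / 13)) (a₁ := (1 : ℚ)) (a₂ := (1 : ℚ)) (b₁ := ((56 : ℚ) / 137)) (b₂ := ((34 : ℚ) / 65))
      (c₁ := ((121 : ℚ) / 1370)) (c₂ := ((123 : ℚ) / 1300)) (v₁ := ((3983 : ℚ) / 5000)) (v₂ := ((4759 : ℚ) / 5000)) (e := ((9471 : ℚ) / 10000)) (E := ((8001 : ℚ) / 10000))
      (q₁ := ((2597 : ℚ) / 10000)) (q₂ := ((2123 : ℚ) / 5000)) (by decide +kernel)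
      (Δ := Δ') (tpd := 1) (tpp := b') (c := c') (by simpa using hΔ') (by simp) (by simpa using hb') (by simpa using hc')
    obtain ⟨-, -, -, -, -, hwin⟩ := h
    push_cast at hwin
    have ht := vhFrac_1_4
    have hmono := vhFrac_anti (show (1 / 4 : ℝ) ≤ ((2597 : ℝ) / 10000) by norm_num)
    have hnu : ((63817 : ℝ) / 147456) ≤ ((91 : ℝ) / 200) := by norm_num
    linarith [hwin.1, ht.2]
  have hEh := (fermiEnergyOf_of_pointBracketCheck facePt_NdNiO2YK26_nH109_s3_lo_br (by norm_num) (by norm_num) (by norm_num) (ν := (91/200 : ℝ))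
    (by push_cast; exact ⟨le_rfl, le_rfl⟩)).2
  have hER := (fermiEnergyOf_of_pointBracketCheck facePt_NdNiO2YK26_nH109_s3_R_br (by norm_num) (by norm_num) (by norm_num) (ν := (91/200 : ℝ))
    (by push_cast; exact ⟨le_rfl, le_rfl⟩)).2
  have hEv := (fermiEnergyOf_of_pointBracketCheck facePt_NdNiO2YK26_nH109_s3_hi_br (by norm_num) (by norm_num) (by norm_num) (ν := (91/200 : ℝ))
    (by push_cast; exact ⟨le_rfl, le_rfl⟩)).2
  push_cast at hEh hER hEv
  exact dWeightFace_fermiEnergyOf_mem_Icc_of_mem_box3_num (Eh := ((10133 : ℝ) / 10000)) (ER := ((9783 : ℝ) / 10000)) (Ev := ((8139 : ℝ) / 10000))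
    (by norm_num) one_pos (by norm_num) (by norm_num) hΔn hbn hcn (by norm_num) (by norm_num) hVH hEh.2 (by norm_num)
    (by norm_num [faceU, fsD, fsN, cA]) (by norm_num [faceU, fsD, fsN, cA]) (by norm_num [faceU, fsD, fsN, cA]) (by norm_num [faceU, fsD, fsN, cA])
    hER.1 (by norm_num) hEv.1 (by norm_num) (by norm_num) (by norm_num [faceG])
    (by norm_num [dWeightFaceCF, faceN, faceR, fsN]) (by norm_num [dWeightFaceCF, faceN, faceR, fsN])

/-- **`emeryBoxNdNiO2YK26Src (EmeryBoxesKSlicesD)`, ν = 91/200: for EVERY member θ the Cu-d weight of the antinodal Fermi-surface state lies in `[0.7992, 0.8768]`** (hull of the 3 t_pd slab windows). [folklore] -/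
theorem ndNiO2YK26Box_dWeightFace_nH109 {Δ a b c : ℝ} (hΔ : Δ ∈ Icc ((397 : ℝ) / 100) (5 : ℝ)) (ha : a ∈ Icc ((117 : ℝ) / 100) ((137 : ℝ) / 100)) (hb : b ∈ Icc ((14 : ℝ) / 25) ((17 : ℝ) / 25)) (hc : c ∈ Icc ((121 : ℝ) / 1000) ((123 : ℝ) / 1000)) :
    dWeightFace Δ a b c (fermiEnergyOf Δ a b c ((91 : ℝ) / 200)) ∈ Icc ((999 : ℝ) / 1250) ((548 : ℝ) / 625) := by
  rcases le_or_gt a ((31 : ℝ) / 25) with h1 | h1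
  · have h := ndNiO2YK26Box_dWeightFace_nH109_s1 hΔ ⟨ha.1, h1⟩ hb hc
    exact ⟨le_trans (by norm_num) h.1, le_trans h.2 (by norm_num)⟩
  · rcases le_or_gt a ((13 : ℝ) / 10) with h2 | h2
    · have h := ndNiO2YK26Box_dWeightFace_nH109_s2 hΔ ⟨h1.le, h2⟩ hb hc
      exact ⟨le_trans (by norm_num) h.1, le_trans h.2 (by norm_num)⟩
    · have h := ndNiO2YK26Box_dWeightFace_nH109_s3 hΔ ⟨h2.le, ha.2⟩ hb hc
      exact ⟨le_trans (by norm_num) h.1, le_trans h.2 (by norm_num)⟩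

end Summit.Ventures.CertifiedManyBodySolver.Downfold.Emery
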